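import Summits.NavierStokesRegularity.NavierStokesRegularity.Theorems.ScenarioCensusPressureMeterRows
import HarnessLib

/-!
# LINE «pressure-meter» REV 4 port, part 6/6: §D (second part) `row_A1gw_holds` and the derived cells (`row_A1hw/ma/ac/bw/pw'/pe/p0_holds`), `row_A1pd_of_row_A7s`, summary;
# census KEYS `Row_A1pe` / `Row_A1p0` / `Row_A1pw` / `Row_A1hw` / `Row_A1bw` / `Row_A1gw` / `Row_A1ma` / `Row_A1ac` + `_excluded`, `Row_A1pd` / `Row_A7s` (OPEN)

Re-homed for the scenario census (typer seat ns-census-typer-1 g8; the cells A1pe / A1p0 / A1pw / A1hw / A1bw / A1gw / A1ma / A1ac are MEMBERS OF RECORD «DECIDED IN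
KERNEL IN FILES» of block A2 since census v1.73 (critic idea-crit-3 g7 PASS — no price 00:07:29Z on REV 3, RE-STAMP 00:39:59Z on REV 4; ref ns-census-ref g9
PRE-CHECK ✓ §14.22 item 33 / §14.24 item 33′; lead-presearch label); this port makes them TREE-decided): VERBATIM PORT of ns-idea-2 LINE g13-3 «pressure-meter»
REV 4, `pub/ideators/ns-idea-2/lines/pressure-meter/line-pressure-meter.rev4.lean` sha16 7fb3f23e01caeb0c (1616 l., lean check rc 0, 0 sorry), split for the
400-line rule into `ScenarioCensusPressureMeter` (§A–§C engine) → `…PressureMeterForce` (§C end, §C′ start) → `…PressureMeterWork` (§C′ maximum principle) →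
`…PressureMeterHead` (§C″) → `…PressureMeterRows` (§D rows, nestings) → `…PressureMeterCells` (§D holds + census KEYS).  Lean text VERBATIM in namespace
`…Theorems.ScenarioCensus.PressureMeter` (the line's `…Lines.PressureMeter` re-homed); port edits: `local notation "E3"` → `abbrev E3` (typer lint: no notation in
port files), `@[conjecture]` on the OPEN rows `Row_A1pd` / `Row_A7s` (typed only, ∃-cells), seven one-line docstrings added (gate lint); `tendsto_typeI_bound`
(`C/√(-s) → 0`, twin of a landed tree lemma in a module the farm does not build — gate lint dedup.landed) is not re-declared and its three uses carry the
one-line Mathlib proof inline (proof text only); the line's `set_option maxHeartbeats 400000 in` on the (θ, σ)-engine is kept as filed.  Statements untouched.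

No census VALUE is moved here (the members become TREE-decided by name); NS regularity is NOT proved; (L′) ⟨10661⟩ is untouched; no summit statement is
proved by this file.
-/

-- the summit and its single problem share the name `NavierStokesRegularity` (D-0017 nested layout)
set_option linter.dupNamespace false

noncomputable section

open Set Function Filter Topology Metric

namespace Summit.NavierStokesRegularity.NavierStokesRegularity.Theorems.ScenarioCensus.PressureMeter

open Literature.Analysis Literature.Analysis.FluidPDE InnerProductSpace
open Summit.NavierStokesRegularity.NavierStokesRegularity.Theorems.SimilarityEnstrophy
  (typeI_ancient_eq_zero_of_rate_lt_one)
open scoped Laplacian InnerProductSpace RealInnerProductSpace ContDiff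

/-- **Row A1gw holds** (the two-parameter meter: every `θ`, every `σ ≥ 0`). -/
theorem row_A1gw_holds : Row_A1gw := by
  intro C u hu θ σ η hσ hη hres
  have key : ∀ η' : ℝ, 0 ≤ η' → 2 * η' < 1 →
      (∀ t < 0, ∀ x, ⟪u t x, deriv (fun τ => u τ x) t⟫ + θ * ⟪u t x, convect (u t) (u t) x⟫ -
          σ * ⟪u t x, (Δ (u t)) x⟫ ≤ η' * ‖u t x‖ / ((-t) * Real.sqrt (-t))) →
      ∀ t < 0, ∀ x, u t x = 0 := fun η' h0 h1 h =>
    typeI_ancient_eq_zero_of_rate_lt_one (isTypeIAncientMild_two_mul_of_headWork hu θ hσ h0 h) h1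
  by_cases hη0 : 0 ≤ η
  · exact key η hη0 hη hres
  · push Not at hη0
    refine key 0 le_rfl (by norm_num) fun t ht x => (hres t ht x).trans ?_
    have hden : 0 < (-t) * Real.sqrt (-t) := by
      have : 0 < -t := neg_pos.2 ht
      positivity
    have h1 : η * ‖u t x‖ / ((-t) * Real.sqrt (-t)) ≤ 0 :=
      div_nonpos_of_nonpos_of_nonneg (mul_nonpos_of_nonpos_of_nonneg hη0.le (norm_nonneg _)) hden.le
    have h2 : (0 : ℝ) * ‖u t x‖ / ((-t) * Real.sqrt (-t)) = 0 := by ring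
    linarith

/-- Nesting (PROVED): the meter at `σ = 1` is the head dial. -/
theorem row_A1hw_of_row_A1gw : Row_A1gw → Row_A1hw := by
  intro h C u hu θ η hη hres
  refine h C u hu θ 1 η zero_le_one hη fun t ht x => ?_
  rw [one_mul]
  exact hres t ht x

/-- **Row A1hw holds** (the dial: every weight `θ`). -/
theorem row_A1hw_holds : Row_A1hw := row_A1hw_of_row_A1gw row_A1gw_holds

/-- Nesting (PROVED): the meter at `(θ, σ) = (1, 0)` is the material-acceleration cell. -/
theorem row_A1ma_of_row_A1gw : Row_A1gw → Row_A1ma := by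
  intro h C u hu η hη hres
  refine h C u hu 1 0 η le_rfl hη fun t ht x => ?_
  rw [one_mul, zero_mul, sub_zero, ← inner_add_right]
  exact hres t ht x

/-- **Row A1ma holds.** -/
theorem row_A1ma_holds : Row_A1ma := row_A1ma_of_row_A1gw row_A1gw_holds

/-- Nesting (PROVED): the acceleration window is inside the acceleration-work window (Cauchy–Schwarz). -/
theorem row_A1ac_of_row_A1ma : Row_A1ma → Row_A1ac := by
  intro h C u hu η hη hres
  refine h C u hu η hη fun t ht x => ?_
  have h1 : ⟪u t x, deriv (fun τ => u τ x) t + convect (u t) (u t) x⟫ ≤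
      ‖u t x‖ * ‖deriv (fun τ => u τ x) t + convect (u t) (u t) x‖ := real_inner_le_norm _ _
  have h3 : ‖u t x‖ * ‖deriv (fun τ => u τ x) t + convect (u t) (u t) x‖ ≤
      ‖u t x‖ * (η / ((-t) * Real.sqrt (-t))) :=
    mul_le_mul_of_nonneg_left (hres t ht x) (norm_nonneg _)
  have h4 : ‖u t x‖ * (η / ((-t) * Real.sqrt (-t))) = η * ‖u t x‖ / ((-t) * Real.sqrt (-t)) := by
    ring
  linarith

/-- **Row A1ac holds.** -/
theorem row_A1ac_holds : Row_A1ac := row_A1ac_of_row_A1ma row_A1ma_holds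

/-- Nesting (PROVED): the dial at `θ = 1` is the pressure-work cell. -/
theorem row_A1pw_of_row_A1hw : Row_A1hw → Row_A1pw := by
  intro h C u hu η hη hres
  refine h C u hu 1 η hη fun t ht x => ?_
  have e : ⟪u t x, deriv (fun τ => u τ x) t⟫ + 1 * ⟪u t x, convect (u t) (u t) x⟫ -
      ⟪u t x, (Δ (u t)) x⟫ =
      ⟪u t x, deriv (fun τ => u τ x) t + convect (u t) (u t) x - (Δ (u t)) x⟫ := by
    rw [inner_sub_right, inner_add_right, one_mul]
  rw [e]
  exact hres t ht x

/-- Nesting (PROVED): the dial at `θ = 0` is the Bernoulli-head cell. -/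
theorem row_A1bw_of_row_A1hw : Row_A1hw → Row_A1bw := by
  intro h C u hu η hη hres
  refine h C u hu 0 η hη fun t ht x => ?_
  have e : ⟪u t x, deriv (fun τ => u τ x) t⟫ + 0 * ⟪u t x, convect (u t) (u t) x⟫ -
      ⟪u t x, (Δ (u t)) x⟫ = ⟪u t x, deriv (fun τ => u τ x) t - (Δ (u t)) x⟫ := by
    rw [inner_sub_right, zero_mul, add_zero]
  rw [e]
  exact hres t ht x

/-- **Row A1bw holds.** -/
theorem row_A1bw_holds : Row_A1bw := row_A1bw_of_row_A1hw row_A1hw_holds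

/-- Third proof of `Row_A1pw`, through the dial. -/
theorem row_A1pw_holds' : Row_A1pw := row_A1pw_of_row_A1hw row_A1hw_holds

/-- **Row A1pe holds** (component maximum principle ⇒ Type-I constant `2η < 1` ⇒ the tree's
time-only small-rate Liouville theorem `SimilarityEnstrophy.typeI_ancient_eq_zero_of_rate_lt_one`). -/
theorem row_A1pe_holds : Row_A1pe := by
  intro C u hu η hη hres
  by_cases hη0 : 0 ≤ η
  · have hres' : ∀ t < 0, ∀ x, ‖pressureForce u t x‖ ≤ η / ((-t) * Real.sqrt (-t)) :=
      fun t ht x => by rw [pressureForce_apply]; exact hres t ht x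
    exact typeI_ancient_eq_zero_of_rate_lt_one (isTypeIAncientMild_two_mul hu hη0 hres') hη
  · -- a negative level is impossible: the hypothesis fails at `(t, x) = (-1, 0)`
    exfalso
    push Not at hη0
    have h := hres (-1) (by norm_num) 0
    have h1 : η / (-(-1 : ℝ) * Real.sqrt (-(-1 : ℝ))) = η := by norm_num
    rw [h1] at h
    exact absurd (lt_of_le_of_lt (norm_nonneg _) (lt_of_le_of_lt h hη0)) (lt_irrefl _)

/-- Nesting: the pressureless cell is the level-`0` case of the window. -/
theorem row_A1p0_of_row_A1pe : Row_A1pe → Row_A1p0 := by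
  intro h C u hu hpl
  refine h C u hu 0 (by norm_num) fun t ht x => ?_
  rw [hpl t ht x, sub_self, norm_zero, zero_div]

/-- **Row A1p0 holds.** -/
theorem row_A1p0_holds : Row_A1p0 := row_A1p0_of_row_A1pe row_A1pe_holds

/-- Nesting (PROVED): the one-directional pressure window reduces to the one-small-component cell,
with `η₀ = δ₀/2` (the component maximum principle applied to `e` and `-e`). -/
theorem row_A1pd_of_row_A7s : Row_A7s → Row_A1pd := by
  rintro ⟨δ₀, hδ₀, h⟩
  refine ⟨δ₀ / 2, by positivity, fun C u hu e he hres => ?_⟩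
  have hη : 0 ≤ δ₀ / 2 := by positivity
  have hplus : ∀ t < 0, ∀ x, ⟪e, pressureForce u t x⟫ ≤ δ₀ / 2 / ((-t) * Real.sqrt (-t)) :=
    fun t ht x => by rw [pressureForce_apply]; exact (le_abs_self _).trans (hres t ht x)
  have hminus : ∀ t < 0, ∀ x, ⟪-e, pressureForce u t x⟫ ≤ δ₀ / 2 / ((-t) * Real.sqrt (-t)) :=
    fun t ht x => by
      rw [inner_neg_left, pressureForce_apply]; exact (neg_le_abs _).trans (hres t ht x)
  have hne : ‖-e‖ ≤ 1 := by rw [norm_neg, he]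
  have h1 := inner_le_of_pressureForce hu he.le hη hplus
  have h2 := inner_le_of_pressureForce hu hne hη hminus
  refine h C u hu e he fun t ht x => ?_
  have e1 : 2 * (δ₀ / 2) / Real.sqrt (-t) = δ₀ / Real.sqrt (-t) := by ring
  have ha := h1 t ht x
  have hb := h2 t ht x
  rw [e1] at ha hb
  rw [inner_neg_left] at hb
  exact abs_le.2 ⟨by linarith, ha⟩

/-- Summary: the decided cells of the pressure meter (REV 4: the two-parameter meter, the head dial, the
Bernoulli, pressure-work, pressure-force, pressureless, material-acceleration cells). -/
theorem pressureMeter_cells_decided :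
    Row_A1gw ∧ Row_A1hw ∧ Row_A1bw ∧ Row_A1pw ∧ Row_A1pe ∧ Row_A1p0 ∧ Row_A1ma ∧ Row_A1ac :=
  ⟨row_A1gw_holds, row_A1hw_holds, row_A1bw_holds, row_A1pw_holds, row_A1pe_holds, row_A1p0_holds,
    row_A1ma_holds, row_A1ac_holds⟩

end Summit.NavierStokesRegularity.NavierStokesRegularity.Theorems.ScenarioCensus.PressureMeter

namespace Summit.NavierStokesRegularity.NavierStokesRegularity.Theorems.ScenarioCensus

/-! ## Census KEYS (ns `…Theorems.ScenarioCensus`): instrument PRESSURE METER (block A2) — TREE-decided members A1pe / A1p0 / A1pw / A1hw / A1bw / A1gw / A1ma / A1ac, OPEN rows A1pd / A7s -/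

/-- **Cell A1pe** (pressure-force window `(-t)^{3/2}‖∇p‖ ≤ η`, `2η < 1`, on a Type-I ancient mild field ⇒ `u ≡ 0`): `:= PressureMeter.Row_A1pe`. DECIDED. -/
def Row_A1pe : Prop := PressureMeter.Row_A1pe
/-- A1pe is EXCLUDED (decided in the tree): `PressureMeter.row_A1pe_holds`. -/
theorem row_A1pe_excluded : Row_A1pe := PressureMeter.row_A1pe_holds

/-- **Cell A1p0** (pressureless / viscous vector Burgers ancient fields vanish): `:= PressureMeter.Row_A1p0`. DECIDED. -/
def Row_A1p0 : Prop := PressureMeter.Row_A1p0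
/-- A1p0 is EXCLUDED (decided in the tree): `PressureMeter.row_A1p0_holds`. -/
theorem row_A1p0_excluded : Row_A1p0 := PressureMeter.row_A1p0_holds

/-- **Cell A1pw** (one-sided streamline pressure-work window `⟪u, −∇p⟫ ≤ η(-t)^{-3/2}‖u‖`, `2η < 1`): `:= PressureMeter.Row_A1pw`. DECIDED. -/
def Row_A1pw : Prop := PressureMeter.Row_A1pw
/-- A1pw is EXCLUDED (decided in the tree): `PressureMeter.row_A1pw_holds`. -/
theorem row_A1pw_excluded : Row_A1pw := PressureMeter.row_A1pw_holds

/-- **Cell A1hw(θ)** (generalised-head streamline work `−u·∇(p + (1−θ)|u|²/2) ≤ η(−t)^{−3/2}|u|`, every `θ ∈ ℝ`): `:= PressureMeter.Row_A1hw`. DECIDED. -/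
def Row_A1hw : Prop := PressureMeter.Row_A1hw
/-- A1hw is EXCLUDED (decided in the tree): `PressureMeter.row_A1hw_holds`. -/
theorem row_A1hw_excluded : Row_A1hw := PressureMeter.row_A1hw_holds

/-- **Cell A1bw** (`θ = 0`: Bernoulli-head work window): `:= PressureMeter.Row_A1bw`. DECIDED. -/
def Row_A1bw : Prop := PressureMeter.Row_A1bw
/-- A1bw is EXCLUDED (decided in the tree): `PressureMeter.row_A1bw_holds`. -/
theorem row_A1bw_excluded : Row_A1bw := PressureMeter.row_A1bw_holds

/-- **Cell A1gw(θ, σ)** (model-operator residual `⟪u,∂ₜu⟫ + θ⟪u,(u·∇)u⟫ − σ⟪u,Δu⟫ ≤ η(−t)^{−3/2}|u|`, `σ ≥ 0`, `2η < 1`): `:= PressureMeter.Row_A1gw`. DECIDED. -/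
def Row_A1gw : Prop := PressureMeter.Row_A1gw
/-- A1gw is EXCLUDED (decided in the tree): `PressureMeter.row_A1gw_holds`. -/
theorem row_A1gw_excluded : Row_A1gw := PressureMeter.row_A1gw_holds

/-- **Cell A1ma** (material-acceleration / Lagrangian speed-up window `⟪u, Du/Dt⟫ ≤ η(−t)^{−3/2}|u|`): `:= PressureMeter.Row_A1ma`. DECIDED. -/
def Row_A1ma : Prop := PressureMeter.Row_A1ma
/-- A1ma is EXCLUDED (decided in the tree): `PressureMeter.row_A1ma_holds`. -/
theorem row_A1ma_excluded : Row_A1ma := PressureMeter.row_A1ma_holds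

/-- **Cell A1ac** (small material acceleration `(−t)^{3/2}‖Du/Dt‖ ≤ η`): `:= PressureMeter.Row_A1ac`. DECIDED. -/
def Row_A1ac : Prop := PressureMeter.Row_A1ac
/-- A1ac is EXCLUDED (decided in the tree): `PressureMeter.row_A1ac_holds`. -/
theorem row_A1ac_excluded : Row_A1ac := PressureMeter.row_A1ac_holds

/-- **Row A1pd** (one-directional pressure-force window, ∃ universal `η₀`) — typed only: `:= PressureMeter.Row_A1pd`. OPEN (no witness, no proof). -/
@[conjecture] def Row_A1pd : Prop := PressureMeter.Row_A1pd

/-- **Row A7s** (one scale-invariantly small velocity component, ∃ universal `δ₀`) — typed only: `:= PressureMeter.Row_A7s`. OPEN (no witness, no proof). -/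
@[conjecture] def Row_A7s : Prop := PressureMeter.Row_A7s

/-- Lattice edge at key level: the OPEN row A7s implies the OPEN row A1pd (`PressureMeter.row_A1pd_of_row_A7s`). -/
theorem row_A1pd_of_row_A7s : Row_A7s → Row_A1pd := PressureMeter.row_A1pd_of_row_A7s

end Summit.NavierStokesRegularity.NavierStokesRegularity.Theorems.ScenarioCensus

end
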